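import Summits.SmoothPoincare4.SmoothPoincare4.Theorems.ConvexBisectionPlanarBisectionRigidityStubEtnyrePlanarAcyclicOfFact

/-!
# `PlanarBisectionRigidity` — its exact logical position in route ConvexBisection

Item stmt-SmoothPoincare4-10511 (`ConvexBisection.PlanarBisectionRigidity`, support since the
route-choice repair of 2026-08-16): *every Hausdorff second-countable `C^∞` 4-manifold `M ≃ₕ S⁴`
carrying a Stein bisection along a common contact seam whose `J₁`-induced boundary contact
structure is planar is diffeomorphic to `S⁴`.*

This file records, sorry-free, where the item sits:

* `planarAcyclic_of_planarBisectionRigidity` — it implies the staffed crux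
  `PlanarAcyclicBisectionRigidity` (stmt-SmoothPoincare4-15086: the same statement with the
  ℚ-acyclicity of the halves added as a hypothesis) outright (drop the hypothesis);
* `planarBisectionRigidity_of_etnyreTwo` — conversely it FOLLOWS from that crux together with
  clause (ii) of Etnyre's planar-filling theorem (Etnyre 2004, Thm. 4.1: `H₂(∂W; ℚ) → H₂(W; ℚ)`
  vanishes for a compact Stein domain with planar contact boundary — the right clause of the tree
  fact `Literature.Geometry.Symplectic.EtnyrePlanarFilling`, whose left clause is proved there),
  through the landed Mayer–Vietoris/Lefschetz glue
  `SeamWalkOneSidedBall.stub_etnyrePlanarAcyclicOfFact` (planar seam ⇒ ℚ-acyclic halves);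
* `planarBisectionRigidity_iff_planarAcyclic_of_etnyre` — hence, modulo Etnyre's theorem, the
  item is EQUIVALENT to the crux stmt-SmoothPoincare4-15086 (and, like it, is implied by the
  summit statement: `PlanarBisectionExists.planarBisectionRigidity_of_smoothPoincare4`).
* `planarBisectionRigidity_of_etnyre_of_acyclicRigidity` — and, modulo the same theorem, it is
  implied by crux 2 `AcyclicBisectionRigidity` (stmt-SmoothPoincare4-10507) of the route.

So the item is not closable from the literature alone: its surplus over the open crux is exactly
Etnyre 2004, Thm. 4.1 (ii), and its deficit below `SmoothPoincare4` is the open planar sector.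
-/

noncomputable section

-- the prescribed namespace `Summit.<P>.<Sub>.…` duplicates `SmoothPoincare4` (P = Sub)
set_option linter.dupNamespace false

open scoped Manifold ContDiff Topology ContinuousMap
open Set Function
open Literature.Geometry.Symplectic Literature.AlgebraicTopology.SingularHomology

namespace Summit.SmoothPoincare4.SmoothPoincare4.Theorems.PlanarBisectionRigidity

open Summit.SmoothPoincare4.SmoothPoincare4.Theses.ConvexBisection

/-- **The item implies the planar crux**: `PlanarBisectionRigidity → PlanarAcyclicBisectionRigidity`
(forget the ℚ-acyclicity of the halves). Pure logic. [folklore] -/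
theorem planarAcyclic_of_planarBisectionRigidity (hP : PlanarBisectionRigidity) :
    PlanarAcyclicBisectionRigidity := by
  intro M _ _ _ _ _ e hb
  obtain ⟨W₁, _, _, _, _, W₂, _, _, _, _, J₁, J₂, e₁, e₂, h₁, h₂, hcov, hs₁, hs₂, hξ, -, hp⟩ := hb
  exact hP M e ⟨W₁, _, _, _, _, W₂, _, _, _, _, J₁, J₂, e₁, e₂, h₁, h₂, hcov, hs₁, hs₂, hξ, hp⟩

/-- **The planar crux and Etnyre's clause (ii) imply the item.**  Assume clause (ii) of Etnyre
2004, Thm. 4.1 in the tree's form (`H₂(∂W; ℚ) → H₂(W; ℚ)` is zero for every compact Stein domain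
`W` with planar contact boundary) and `PlanarAcyclicBisectionRigidity`; then
`PlanarBisectionRigidity`: the halves of a planar common-contact Stein bisection of `M ≃ₕ S⁴` are
ℚ-acyclic in positive degrees (`stub_etnyrePlanarAcyclicOfFact`, from the full fact
`EtnyrePlanarFilling`, whose clause (i) is the proved `EtnyrePlanarFilling.left_holds`), so the
crux applies to the same witness. [cite: Etnyre2004, Thm. 4.1] -/
theorem planarBisectionRigidity_of_etnyreTwo
    (hEt₂ : ∀ (W : Type) [TopologicalSpace W] [T2Space W] [ChartedSpace (EuclideanHalfSpace 4) W]
      [IsManifold (𝓡∂ 4) ∞ W] [CompactSpace W] (S : SteinStructure W), PlanarContactBoundary S →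
      singularHomology.map ℚ ℚ
        (⟨Subtype.val, continuous_subtype_val⟩ : C(↥((𝓡∂ 4).boundary W), W)) 2 = 0)
    (hPA : PlanarAcyclicBisectionRigidity) : PlanarBisectionRigidity := by
  have hEt : EtnyrePlanarFilling := EtnyrePlanarFilling.iff_right.2 hEt₂
  intro M _ _ _ _ _ e hb
  obtain ⟨W₁, _, _, _, _, W₂, _, _, _, _, J₁, J₂, e₁, e₂, h₁, h₂, hcov, hs₁, hs₂, hξ, hp⟩ := hb
  have hacyc := SeamWalkOneSidedBall.stub_etnyrePlanarAcyclicOfFact hEt M e W₁ W₂ J₁ J₂ e₁ e₂ h₁ h₂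
    hcov hs₁ hs₂ hξ hp
  exact hPA M e ⟨W₁, _, _, _, _, W₂, _, _, _, _, J₁, J₂, e₁, e₂, h₁, h₂, hcov, hs₁, hs₂, hξ, hacyc, hp⟩

/-- **The item from the full Etnyre fact and the planar crux**:
`EtnyrePlanarFilling → PlanarAcyclicBisectionRigidity → PlanarBisectionRigidity`.
[cite: Etnyre2004, Thm. 4.1] -/
theorem planarBisectionRigidity_of_etnyre (hEt : EtnyrePlanarFilling)
    (hPA : PlanarAcyclicBisectionRigidity) : PlanarBisectionRigidity :=
  planarBisectionRigidity_of_etnyreTwo hEt.2 hPA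

/-- **Modulo Etnyre 2004, Thm. 4.1 the item IS the planar crux**:
`EtnyrePlanarFilling → (PlanarBisectionRigidity ↔ PlanarAcyclicBisectionRigidity)`.
[cite: Etnyre2004, Thm. 4.1] -/
theorem planarBisectionRigidity_iff_planarAcyclic_of_etnyre (hEt : EtnyrePlanarFilling) :
    PlanarBisectionRigidity ↔ PlanarAcyclicBisectionRigidity :=
  ⟨planarAcyclic_of_planarBisectionRigidity, planarBisectionRigidity_of_etnyre hEt⟩

/-- **Sector glue, both forms agree modulo Etnyre**: given `EtnyrePlanarFilling`, the Etnyre-free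
glue `AcyclicRigidityBySectorsPA` (stmt-SmoothPoincare4-15087) yields the original glue
`AcyclicRigidityBySectors` (stmt-SmoothPoincare4-14770) with this item in the planar slot, and
conversely without any fact. Pure logic over the two implications above. [folklore] -/
theorem acyclicRigidityBySectors_iff_PA_of_etnyre (hEt : EtnyrePlanarFilling) :
    AcyclicRigidityBySectors ↔ AcyclicRigidityBySectorsPA := by
  constructor
  · intro h hPA hC hR
    exact h (planarBisectionRigidity_of_etnyre hEt hPA) hC hR
  · intro h hP hC hR
    exact h (planarAcyclic_of_planarBisectionRigidity hP) hC hR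

/-- **Closing crux 2 closes the item, modulo Etnyre**:
`EtnyrePlanarFilling → AcyclicBisectionRigidity → PlanarBisectionRigidity` — the halves of a planar
common-contact Stein bisection of `M ≃ₕ S⁴` are ℚ-acyclic in positive degrees
(`SeamWalkOneSidedBall.stub_etnyrePlanarAcyclicOfFact`), so crux 2 of the route
(stmt-SmoothPoincare4-10507, rationally acyclic halves, no planarity) applies to the same witness.
Equivalently: `AcyclicBisectionRigidity → PlanarAcyclicBisectionRigidity` (drop the planarity
conjunct) composed with `planarBisectionRigidity_of_etnyre`. [cite: Etnyre2004, Thm. 4.1] -/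
theorem planarBisectionRigidity_of_etnyre_of_acyclicRigidity (hEt : EtnyrePlanarFilling)
    (hR : AcyclicBisectionRigidity) : PlanarBisectionRigidity := by
  intro M _ _ _ _ _ e hb
  obtain ⟨W₁, _, _, _, _, W₂, _, _, _, _, J₁, J₂, e₁, e₂, h₁, h₂, hcov, hs₁, hs₂, hξ, hp⟩ := hb
  have hacyc := SeamWalkOneSidedBall.stub_etnyrePlanarAcyclicOfFact hEt M e W₁ W₂ J₁ J₂ e₁ e₂ h₁ h₂
    hcov hs₁ hs₂ hξ hp
  exact hR M e ⟨W₁, _, _, _, _, W₂, _, _, _, _, J₁, J₂, e₁, e₂, h₁, h₂, hcov, hs₁, hs₂, hξ, hacyc⟩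

end Summit.SmoothPoincare4.SmoothPoincare4.Theorems.PlanarBisectionRigidity

end
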